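import Summits.HodgeConjecture.HodgeConjecture.Theorems.R90S4TwistedCartanNormFibres   -- ★ α p863634 (R90-C131-p03): the norm fibre `S_γ = N⁻¹(γ) ⊆ T̃`, its `(1−ε)T̃`-cosets are the ε-classes, `{c | IsStablyEpsConjAt … δ₀ (out c)} = ⟦·⟧ '' S_γ` (brings ★ `R90S4CartanNormMap`: `N` multiplicative on `T̃`, `N : T̃ → T` onto)
import HarnessLib

/-!
# R90-TF · S4 «Ch. 13.1–2», T-WIF road, head A4 (FIN) — THE ε-CLASSES OVER A REGULAR `γ` ARE FINITELY MANY, and their number is the number of `(1−ε)T̃`-cosets in `T̃ᴺ`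
# (Rogawski 1990, §3.11 Prop. 3.11.1 (c) p. 34: `𝒟_ε(δ∕F)` finite; §12.5 p. 186: the fibres of `T̃ → T`, `|Z̃T̃ᴺ ∕ …|`)

Cell `hodgecm-mathlib`, crux H413 (`stmt-HodgeConjecture-24833`, lane `--supports … --as helper`), route of record `HCCMUnconditional` (no route verbs; count-neutral).
Programme R90-TF, section S4, dealer K2E2-plan (g7): S4-R27 (3) «A4 (FIN) + (IDX) → p27 after (DICT)(3)» over the HEADS SHEET v2 `R90/R90-C131-p03/g2/HEADS-TWIF-tube.v2.md`
(786783e34fca23ca) §5′ rows «A4 FIN» ∕ «IDX»; seat K2E3-p27 (g3).  Sequel of ★ α `R90S4TwistedCartanNormFibres` (R90-C131-p03 (g2)).  THEOREMS ONLY — no `def`, no instance,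
no notation, no `sorry`; ★-only imports.

## THE MATHEMATICS
Setting of ★ α: `G_v = U(Φ)(L⁺_v) ⊂ G̃_v = GL₃(L ⊗ L⁺_v)`, `Φ` hermitian, `ε = epsLoc L Φ v`, `N δ = δ ε(δ)`; `γ ∈ G_v` REGULAR, `T̃ = Cent_{G̃_v}(γ)` (abelian, ε-stable), the NORM FIBRE
`S_γ = {t : N t = γ}` (non-empty: ★ `exists_mem_centralizer_epsNorm_eq`, `N : T̃ → T` is onto), `T̃ᴺ = {u ∈ T̃ : N u = 1}`, `C_T = {s ε(s)⁻¹ : s ∈ T̃} ⊆ T̃ᴺ`.  By ★ α the index set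
of the stable ε-orbital integral `Φ^{st}_ε(δ₀, ·)` at any `δ₀` with `γ ∈ 𝒩(δ₀)` is `⟦·⟧ '' S_γ`, and two points of `S_γ` have the same class iff they differ by `C_T`.  Since `N` is
multiplicative on `T̃`, `S_γ = t₀ · T̃ᴺ` for any base point `t₀ ∈ S_γ`; hence (§1) **`finite_setOf_isStablyEpsConjAt_of_normCosetsFinite`**: the index set is FINITE as soon as `T̃ᴺ` is
covered by finitely many `C_T`-cosets (letter (K-FIN), hypothesis `hK`), and (§2) **`ncard_setOf_isStablyEpsConjAt_eq_card`**: its cardinal is `|R|` for any TRANSVERSAL `R` of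
`T̃ᴺ ∕ C_T` (a finite set of representatives: covering + pairwise inequivalent) — print's `|𝒟_ε(δ∕F)| = |T̃ᴺ ∕ (1−ε)T̃|`, the count `|K_T|` that the norm push (M4) and (WEYL-COUNT)
consume.  Reading `ε(s) = (s⋆)⁻¹`: `T̃ᴺ` = the `⋆`-fixed units of the Cartan algebra `Z(γ)` and `C_T` = its `⋆`-norms, so (K-FIN) is ★ `Rogawski1990.exists_finset_norm_classes`
(finitely many norm classes over a local field) and `|R| = |H¹(F, T)| = 2^{r′}` by Cartan type [§3.6] — the (IDX) letter, discharged in the sequel; for a CUBIC Cartan (`Z(γ)` a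
field) `|R| = 2` by ★ `R90S4CartanFieldNormIndex.exists_fixed_nonnorm_dichotomy_of_finiteDimensional`.

## CONTENTS
* §1 `epsNorm_eq_one_of_mem_normFibre` (`t₀, t ∈ S_γ ⇒ N(t₀⁻¹t) = 1`), `epsNorm_mul_eq_coe_of_epsNorm_eq_one` (`N(t₀u) = γ` for `u ∈ T̃ᴺ`),
  **`finite_setOf_isStablyEpsConjAt_of_normCosetsFinite`** ((FIN), hypothesis-first over (K-FIN)).
* §2 **`ncard_setOf_isStablyEpsConjAt_eq_card`** (the count = the size of a transversal of `T̃ᴺ ∕ C_T`).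

HONEST LABEL: HC_CM is proved only modulo the 7 printed citations (2 remaining named inputs: hLiu418 = stmt-HodgeConjecture-24832, h413 = stmt-HodgeConjecture-24833) until rung 0
closes.  Group algebra toward T-WIF (B1); discharges no named input; (W-NP) ∕ (B1) ∕ (1D-CT)_ns OPEN.  REL ≠ ★ ≠ BUILT.

## References
* [Rogawski1990] J. D. Rogawski, *Automorphic Representations of Unitary Groups in Three Variables*, Ann. of Math. Stud. 123 (1990), §3.11 Prop. 3.11.1 (b)(c), Prop. 3.11.2
  pp. 34–35; §12.5 p. 186; §3.6 p. 31.
* [Kottwitz1982] R. E. Kottwitz, *Rational conjugacy classes in reductive groups*, Duke Math. J. 49 (1982), §5 (twisted classes and `H¹`).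
-/

set_option autoImplicit false
-- the mandated namespace repeats the single-problem summit's segment (`HodgeConjecture.HodgeConjecture`)
set_option linter.dupNamespace false

noncomputable section

open scoped NumberField Matrix MatrixGroups

namespace Summit.HodgeConjecture.HodgeConjecture.R90.S4

open Literature.NumberTheory.Rogawski1990 Literature.NumberTheory.Rogawski1990.Ch4Sec10
open Literature.NumberTheory.Automorphic
open IsDedekindDomain NumberField

section Finite

variable (L : Type) [Field L] [NumberField L] [IsCMField L] (Φ : GL (Fin 3) L) (v : HeightOneSpectrum (𝓞 ↥(maximalRealSubfield L)))

/-! ## §1 `S_γ = t₀ · T̃ᴺ`, and (FIN) hypothesis-first -/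

variable {L Φ v} in
/-- **Two points of the norm fibre differ by `T̃ᴺ`**: `N t₀ = N t = γ` (`γ` regular, `Φ` hermitian) ⇒ `t₀⁻¹ t ∈ T̃` and `N(t₀⁻¹ t) = 1` (`N` is multiplicative on the abelian
`T̃ ⊇ S_γ`, ★ `epsNorm_mul_of_mem_centralizer`, ★ `mem_centralizer_of_epsNorm_eq_coe`). [cite: Rogawski1990, §12.5 p. 186; §3.11 Prop. 3.11.1 (c) p. 34] -/
theorem epsNorm_eq_one_of_mem_normFibre
    (hΦ : ((Φ : GL (Fin 3) L) : Matrix (Fin 3) (Fin 3) L)ᵀ.map (IsCMField.complexConj L) = (Φ : Matrix (Fin 3) (Fin 3) L))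
    {γ : (UnitaryGroup.cmDatum L 3 (Φ : Matrix (Fin 3) (Fin 3) L)).Local v} (hγ : IsRegularElt (γ.val : GtLoc L v)) {t₀ t : GtLoc L v}
    (ht₀ : epsNorm (epsLoc L Φ v) t₀ = γ.val) (ht : epsNorm (epsLoc L Φ v) t = γ.val) :
    t₀⁻¹ * t ∈ Subgroup.centralizer ({(γ.val : GtLoc L v)} : Set (GtLoc L v)) ∧ epsNorm (epsLoc L Φ v) (t₀⁻¹ * t) = 1 := by
  have ht₀T := mem_centralizer_of_epsNorm_eq_coe hΦ ht₀
  have htT := mem_centralizer_of_epsNorm_eq_coe hΦ ht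
  have huT : t₀⁻¹ * t ∈ Subgroup.centralizer ({(γ.val : GtLoc L v)} : Set (GtLoc L v)) := Subgroup.mul_mem _ (Subgroup.inv_mem _ ht₀T) htT
  refine ⟨huT, ?_⟩
  have h := epsNorm_mul_of_mem_centralizer (Φ := Φ) hγ ht₀T huT
  rw [mul_inv_cancel_left, ht, ht₀] at h
  exact (mul_eq_left.1 h.symm)

variable {L Φ v} in
/-- **`t₀ · T̃ᴺ ⊆ S_γ`**: `N t₀ = γ`, `u ∈ T̃` with `N u = 1` ⇒ `N(t₀ u) = γ`. [cite: Rogawski1990, §12.5 p. 186] -/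
theorem epsNorm_mul_eq_coe_of_epsNorm_eq_one
    (hΦ : ((Φ : GL (Fin 3) L) : Matrix (Fin 3) (Fin 3) L)ᵀ.map (IsCMField.complexConj L) = (Φ : Matrix (Fin 3) (Fin 3) L))
    {γ : (UnitaryGroup.cmDatum L 3 (Φ : Matrix (Fin 3) (Fin 3) L)).Local v} (hγ : IsRegularElt (γ.val : GtLoc L v)) {t₀ u : GtLoc L v}
    (ht₀ : epsNorm (epsLoc L Φ v) t₀ = γ.val) (hu : u ∈ Subgroup.centralizer ({(γ.val : GtLoc L v)} : Set (GtLoc L v))) (hNu : epsNorm (epsLoc L Φ v) u = 1) :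
    epsNorm (epsLoc L Φ v) (t₀ * u) = γ.val := by
  rw [epsNorm_mul_of_mem_centralizer (Φ := Φ) hγ (mem_centralizer_of_epsNorm_eq_coe hΦ ht₀) hu, hNu, mul_one, ht₀]

variable {L Φ v} in
/-- **(FIN), HYPOTHESIS-FIRST — the ε-classes over a regular `γ` are finitely many** provided (K-FIN): `T̃ᴺ = {u ∈ T̃ : N u = 1}` is covered by finitely many cosets of
`C_T = {s ε(s)⁻¹ : s ∈ T̃}`.  For `Φ` hermitian, `γ ∈ G_v` regular and any `δ₀` with `γ ∈ 𝒩(δ₀)`, the index set `{c | IsStablyEpsConjAt … δ₀ (out c)}` of ★ `stableEpsOrbitalIntegral`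
is finite: it is `⟦·⟧ '' S_γ` (★ α), `S_γ = t₀ · T̃ᴺ` (`t₀` a base point, ★ `exists_mem_centralizer_epsNorm_eq`), and `t₀ u ∼_ε t₀ r` when `u = r · s ε(s)⁻¹` (★ α
`isEpsConj_mul_mul_epsLoc_inv_of_commute`), so the classes are among the `⟦t₀ r⟧`, `r ∈ R`.  (K-FIN) is finiteness of the norm classes `H¹(F, T) = (Z(γ)^⋆)ˣ ∕ N` over the local
field [§3.5 Prop. 3.5.2], ★ `Rogawski1990.exists_finset_norm_classes` in `⋆`-currency; discharged in the sequel. [cite: Rogawski1990, §3.11 Prop. 3.11.1 (c) p. 34; §12.5 p. 186]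
[cite: Kottwitz1982, §5] -/
theorem finite_setOf_isStablyEpsConjAt_of_normCosetsFinite
    (hΦ : ((Φ : GL (Fin 3) L) : Matrix (Fin 3) (Fin 3) L)ᵀ.map (IsCMField.complexConj L) = (Φ : Matrix (Fin 3) (Fin 3) L))
    {γ : (UnitaryGroup.cmDatum L 3 (Φ : Matrix (Fin 3) (Fin 3) L)).Local v} (hγ : IsRegularElt (γ.val : GtLoc L v)) {δ₀ : GtLoc L v} (hδ₀ : IsEpsNormPair L Φ v δ₀ γ)
    (hK : ∃ R : Finset (GtLoc L v), ∀ u ∈ Subgroup.centralizer ({(γ.val : GtLoc L v)} : Set (GtLoc L v)), epsNorm (epsLoc L Φ v) u = 1 →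
      ∃ r ∈ R, ∃ s ∈ Subgroup.centralizer ({(γ.val : GtLoc L v)} : Set (GtLoc L v)), u = r * (s * (epsLoc L Φ v s)⁻¹)) :
    {c : EpsConjClassesMod (epsLoc L Φ v) ⊥ | IsStablyEpsConjAt L Φ v δ₀ (Quotient.out c)}.Finite := by
  classical
  obtain ⟨R, hR⟩ := hK
  rw [setOf_isStablyEpsConjAt_out_eq_image_normFibre hΦ hδ₀]
  -- a base point `t₀ ∈ S_γ ∩ T̃`
  obtain ⟨t₀, ht₀T, ht₀⟩ := exists_mem_centralizer_epsNorm_eq L Φ v γ (t := γ) (Subgroup.mem_centralizer_singleton_iff.2 rfl)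
  refine ((R.finite_toSet.image fun r : GtLoc L v =>
    (Quotient.mk (Relation.EqvGen.setoid (epsConjModRel (epsLoc L Φ v) ⊥)) (t₀ * r) : EpsConjClassesMod (epsLoc L Φ v) ⊥)).subset ?_)
  rintro c ⟨t, ht, rfl⟩
  obtain ⟨huT, hNu⟩ := epsNorm_eq_one_of_mem_normFibre hΦ hγ ht₀ ht
  obtain ⟨r, hrR, s, hsT, hu⟩ := hR _ huT hNu
  refine ⟨r, Finset.mem_coe.2 hrR, ?_⟩
  -- `t = t₀ r · s ε(s)⁻¹` with `r ∈ T̃`, so `t₀ r ∼_ε t`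
  have hsε : s * (epsLoc L Φ v s)⁻¹ ∈ Subgroup.centralizer ({(γ.val : GtLoc L v)} : Set (GtLoc L v)) :=
    Subgroup.mul_mem _ hsT (Subgroup.inv_mem _ (epsLoc_mem_centralizer_coe γ hsT))
  have hrT : r ∈ Subgroup.centralizer ({(γ.val : GtLoc L v)} : Set (GtLoc L v)) := by
    have hr : r = t₀⁻¹ * t * (s * (epsLoc L Φ v s)⁻¹)⁻¹ := by rw [hu, mul_inv_cancel_right]
    rw [hr]
    exact Subgroup.mul_mem _ huT (Subgroup.inv_mem _ hsε)
  have ht_eq : t = t₀ * r * (s * (epsLoc L Φ v s)⁻¹) := by rw [mul_assoc, ← hu, mul_inv_cancel_left]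
  change (Quotient.mk (Relation.EqvGen.setoid (epsConjModRel (epsLoc L Φ v) ⊥)) (t₀ * r) : EpsConjClassesMod (epsLoc L Φ v) ⊥) =
    Quotient.mk (Relation.EqvGen.setoid (epsConjModRel (epsLoc L Φ v) ⊥)) t
  rw [epsConjClassesMod_mk_eq_mk_iff, ht_eq]
  exact isEpsConj_mul_mul_epsLoc_inv_of_commute (mul_comm_of_mem_centralizer_of_isRegularElt hγ hsT (Subgroup.mul_mem _ ht₀T hrT))

/-! ## §2 The count: the number of ε-classes over `γ` is the size of a transversal of `T̃ᴺ ∕ C_T` -/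

variable {L Φ v} in
/-- **`|{ε-classes over γ}| = |R|` FOR A TRANSVERSAL `R` OF `T̃ᴺ ∕ C_T`** (`Φ` hermitian, `γ` regular, `γ ∈ 𝒩(δ₀)`).  `R ⊆ T̃ᴺ` finite (`hRT`), covering `T̃ᴺ` by `C_T`-cosets
(`hRcov`) and pairwise inequivalent (`hRinj`): then `{c | IsStablyEpsConjAt … δ₀ (out c)}.ncard = R.card` — the map `r ↦ ⟦t₀ r⟧` is a bijection from `R` onto the index set (onto
by §1; one-to-one by ★ α `epsConjClassesMod_mk_eq_mk_iff_of_epsNorm_eq_coe`: `⟦t₀ r⟧ = ⟦t₀ r′⟧ ⟺ r′ ∈ r · C_T`).  This is `|𝒟_ε(δ∕F)| = |T̃ᴺ ∕ (1−ε)T̃| = |K_T|`; per Cartan type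
`|K_T| = |H¹(F,T)| = 2^{r′}` [§3.6] is the (IDX) letter (a transversal of that size), e.g. `R = {1, c·1}` for a cubic Cartan. [cite: Rogawski1990, §3.11 Prop. 3.11.1 (c) p. 34; §12.5 p. 186]
[cite: Kottwitz1982, §5] -/
theorem ncard_setOf_isStablyEpsConjAt_eq_card
    (hΦ : ((Φ : GL (Fin 3) L) : Matrix (Fin 3) (Fin 3) L)ᵀ.map (IsCMField.complexConj L) = (Φ : Matrix (Fin 3) (Fin 3) L))
    {γ : (UnitaryGroup.cmDatum L 3 (Φ : Matrix (Fin 3) (Fin 3) L)).Local v} (hγ : IsRegularElt (γ.val : GtLoc L v)) {δ₀ : GtLoc L v} (hδ₀ : IsEpsNormPair L Φ v δ₀ γ)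
    (R : Finset (GtLoc L v))
    (hRT : ∀ r ∈ R, r ∈ Subgroup.centralizer ({(γ.val : GtLoc L v)} : Set (GtLoc L v)) ∧ epsNorm (epsLoc L Φ v) r = 1)
    (hRcov : ∀ u ∈ Subgroup.centralizer ({(γ.val : GtLoc L v)} : Set (GtLoc L v)), epsNorm (epsLoc L Φ v) u = 1 →
      ∃ r ∈ R, ∃ s ∈ Subgroup.centralizer ({(γ.val : GtLoc L v)} : Set (GtLoc L v)), u = r * (s * (epsLoc L Φ v s)⁻¹))
    (hRinj : ∀ r ∈ R, ∀ r' ∈ R, (∃ s ∈ Subgroup.centralizer ({(γ.val : GtLoc L v)} : Set (GtLoc L v)), r' = r * (s * (epsLoc L Φ v s)⁻¹)) → r = r') :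
    {c : EpsConjClassesMod (epsLoc L Φ v) ⊥ | IsStablyEpsConjAt L Φ v δ₀ (Quotient.out c)}.ncard = R.card := by
  classical
  obtain ⟨t₀, ht₀T, ht₀⟩ := exists_mem_centralizer_epsNorm_eq L Φ v γ (t := γ) (Subgroup.mem_centralizer_singleton_iff.2 rfl)
  let f : GtLoc L v → EpsConjClassesMod (epsLoc L Φ v) ⊥ := fun r =>
    Quotient.mk (Relation.EqvGen.setoid (epsConjModRel (epsLoc L Φ v) ⊥)) (t₀ * r)
  -- the index set is `f '' R`
  have himage : {c : EpsConjClassesMod (epsLoc L Φ v) ⊥ | IsStablyEpsConjAt L Φ v δ₀ (Quotient.out c)} = f '' (R : Set (GtLoc L v)) := by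
    rw [setOf_isStablyEpsConjAt_out_eq_image_normFibre hΦ hδ₀]
    ext c
    constructor
    · rintro ⟨t, ht, rfl⟩
      obtain ⟨huT, hNu⟩ := epsNorm_eq_one_of_mem_normFibre hΦ hγ ht₀ ht
      obtain ⟨r, hrR, s, hsT, hu⟩ := hRcov _ huT hNu
      refine ⟨r, Finset.mem_coe.2 hrR, ?_⟩
      have ht_eq : t = t₀ * r * (s * (epsLoc L Φ v s)⁻¹) := by rw [mul_assoc, ← hu, mul_inv_cancel_left]
      change (Quotient.mk (Relation.EqvGen.setoid (epsConjModRel (epsLoc L Φ v) ⊥)) (t₀ * r) : EpsConjClassesMod (epsLoc L Φ v) ⊥) =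
        Quotient.mk (Relation.EqvGen.setoid (epsConjModRel (epsLoc L Φ v) ⊥)) t
      rw [epsConjClassesMod_mk_eq_mk_iff, ht_eq]
      exact isEpsConj_mul_mul_epsLoc_inv_of_commute (mul_comm_of_mem_centralizer_of_isRegularElt hγ hsT (Subgroup.mul_mem _ ht₀T (hRT r hrR).1))
    · rintro ⟨r, hrR, rfl⟩
      exact ⟨t₀ * r, epsNorm_mul_eq_coe_of_epsNorm_eq_one hΦ hγ ht₀ (hRT r hrR).1 (hRT r hrR).2, rfl⟩
  -- `f` is one-to-one on `R`
  have hinj : Set.InjOn f (R : Set (GtLoc L v)) := by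
    intro r hr r' hr' hrr'
    have hr₀ := epsNorm_mul_eq_coe_of_epsNorm_eq_one hΦ hγ ht₀ (hRT r hr).1 (hRT r hr).2
    have hr₀' := epsNorm_mul_eq_coe_of_epsNorm_eq_one hΦ hγ ht₀ (hRT r' hr').1 (hRT r' hr').2
    obtain ⟨s, hsT, hs⟩ := (epsConjClassesMod_mk_eq_mk_iff_of_epsNorm_eq_coe hΦ hγ hr₀ hr₀').1 hrr'
    refine hRinj r hr r' hr' ⟨s, hsT, ?_⟩
    rw [mul_assoc] at hs
    exact mul_left_cancel hs
  rw [himage, hinj.ncard_image, Set.ncard_coe_finset]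

end Finite

end Summit.HodgeConjecture.HodgeConjecture.R90.S4

end
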